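import Summits.CriticalPhenomena.PercolationContinuityZ3.Theorems.PercNearOneGluingNoHeavyQuantTwoPointHubSliverHigh
import HarnessLib

/-!
# QUANT lane R8, FAR on trees: TP1 in the sliver when the credited gate is `≤ 1/2` (Cantelli with a discounted hub),
# and the UNCONDITIONAL two-point-hub inequality TP1-sliver (= (B-4) of the profile conjecture)

builds on p205010 (kernel theorem, internal audit signed; external expert review pending)

Support file (`--supports stmt-CriticalPhenomena-4575`), QUANT lane seat prim-quant-census-2 (gen 47); memo
`run/shared/lean/prim/quant/prim-quant-census-2-g47/B4-CANTELLI-G47.md`.  Theorems only; no sorries; standard axioms.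

**Setting** (as in `…QuantTwoPointHubSliver`).  `W = Σ_k a_k ζ_k`: independent blobs with integer sizes `a k` and gates `p k`,
least reliable blob `y₀` (`g := p y₀ ≤ p k`); integers `1 ≤ i`, `i + 1 ≤ c`, `c + 1 ≤ y`, a real `d ∈ (0,1)` with `i + d < c`,
and the sliver hypothesis `EW > 2y − 2 − d`; `λ = (i+d)/c`, `ρ = (2i+d)/(i+c)`; the claim TP1-sliver is
`min(ρ, g) ≤ (1 − λ)·P(y ≤ W) + λ·P(y − c ≤ W)` — the two-point hub `Y ∈ {i, i+c}` of mean `2i + d` at level `s = y + i`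
(census-2 gen 46, TP-REDUCTION-SURPLUS-FAR R1; census-1 gen 10/11, PROFILE-PROOF-G10 §11 and B4-SLIVER-G11).

* `Quant.IndepBlob.gate_le_tail_of_size_le` — a blob of size `≥ y` alone reaches level `y`: `y ≤ a k ⟹ p k ≤ P(y ≤ W)`.
* `Quant.IndepBlob.twoPointHub_sliver_of_min_le_half` — **TP1-sliver whenever `min(ρ, g) ≤ 1/2`** (in particular whenever the least
  block gate is `≤ 1/2`).  Proof: if some block has size `≥ y` the left side is `≥ P(y ≤ W) ≥ g`.  Otherwise apply CANTELLI to the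
  joint count `X = c·ε + W` (`ε ~ Ber(λ)` the hub leg, mean `m = (i + d) + EW`, light level `j = y − 1`, `Δ := m − j > j + i`):
  `4Δ²·P(X ≤ j) ≤ Var X + Δ²`, and the hub's variance is DISCOUNTED by its credit, `c²λ(1−λ) = (i+d)·c(1−λ) ≤ (i+d)·(1−ρ)(i+c)`,
  while `Σ a_k² p_k (1−p_k) ≤ j (1−g) EW`; with `t = 1 − min(ρ,g) ≥ 1/2` this gives `Var X ≤ t (j·EW + (i+c)(i+d)) ≤ 2tΔ²`
  (the last step is `(2Δ + j)(Δ − j − i) + i(2Δ + j − i − d) + (j − c)(i + d) ≥ 0`), hence `P(X ≤ j) ≤ (2t+1)/4 ≤ t`.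
* `Quant.IndepBlob.twoPointHub_sliver` — **TP1-sliver, UNCONDITIONAL**: the half `1/2 ≤ g` is census-1 gen 11's
  `twoPointHub_sliver_of_half_le_gate` (Hall–Harris rows), the half `g < 1/2` is the Cantelli theorem above.
  This closes (B-4), the last blob-sum input of census-1 gen 10's proof of `Quant.HubBlocksProfileIneq` along
  PROFILE-PROOF-G10 §2–§5/§11 (the vertex step R1 and the assembly remain to be typed).
Numerics (memo): the four-regime proof certified instance-wise on 288 755 exact instances (0 failures); the variance bound and
`Δ > j + i` asserted in all 31 339 Cantelli-regime instances. [this work]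
-/

namespace Summit.CriticalPhenomena.PercolationContinuityZ3.Theorems

namespace Quant

namespace IndepBlob

open Finset

variable {κ : Type*} [Fintype κ] [DecidableEq κ]

/-- A single blob of size at least `y` reaches level `y` on its own: `y ≤ a k₀ ⟹ p k₀ ≤ P(y ≤ W)`. [folklore] -/
theorem gate_le_tail_of_size_le (p : κ → ℝ) (a : κ → ℕ) (hp0 : ∀ k, 0 ≤ p k) (hp1 : ∀ k, p k ≤ 1)
    (k₀ : κ) (y : ℕ) (hk₀ : y ≤ a k₀) :
    p k₀ ≤ ∑ s ∈ (Finset.univ : Finset (Finset κ)).filter (fun s => y ≤ ∑ k ∈ s, a k),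
      (∏ k, if k ∈ s then p k else 1 - p k) := by
  have hw0 : ∀ s : Finset κ, 0 ≤ (∏ k, if k ∈ s then p k else 1 - p k) := bernoulliWeight_nonneg hp0 hp1
  have h1 := sum_bernoulliWeight_mul_indicator p k₀
  have h2 : ∑ W : Finset κ, (∏ k, if k ∈ W then p k else 1 - p k) * (if k₀ ∈ W then (1 : ℝ) else 0) =
      ∑ W ∈ (Finset.univ : Finset (Finset κ)).filter (fun W => k₀ ∈ W), (∏ k, if k ∈ W then p k else 1 - p k) := by
    rw [Finset.sum_filter]
    refine Finset.sum_congr rfl fun W _ => ?_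
    split_ifs <;> simp
  rw [← h1, h2]
  refine Finset.sum_le_sum_of_subset_of_nonneg (fun W hW => ?_) fun W _ _ => hw0 W
  rw [Finset.mem_filter] at hW ⊢
  exact ⟨hW.1, hk₀.trans (Finset.single_le_sum (fun k _ => Nat.zero_le (a k)) hW.2)⟩

/-- **TP1-sliver when the credited gate is at most `1/2`** (Cantelli with a discounted hub).  Gates `0 ≤ p k ≤ 1` with least
reliable blob `y₀`; integer sizes `a k`; integers `1 ≤ i`, `i + 1 ≤ c`, `c + 1 ≤ y`; a real `0 < d < 1` with `i + d < c`;
`2y − 2 − d < EW`; and `min((2i+d)/(i+c), p y₀) ≤ 1/2`.  Then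
`min((2i+d)/(i+c), p y₀) ≤ (1 − (i+d)/c)·P(y ≤ W) + ((i+d)/c)·P(y − c ≤ W)`. [this work] -/
theorem twoPointHub_sliver_of_min_le_half (p : κ → ℝ) (a : κ → ℕ) (hp0 : ∀ k, 0 ≤ p k) (hp1 : ∀ k, p k ≤ 1)
    (y₀ : κ) (hy₀ : ∀ k, p y₀ ≤ p k) (i c y : ℕ) (d : ℝ) (hi : 1 ≤ i) (hic : i + 1 ≤ c) (hcy : c + 1 ≤ y)
    (hd0 : 0 < d) (hd1 : d < 1) (hdc : (i : ℝ) + d < c)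
    (hEW : 2 * (y : ℝ) - 2 - d < ∑ k, (a k : ℝ) * p k)
    (hhalf : min ((2 * (i : ℝ) + d) / ((i : ℝ) + c)) (p y₀) ≤ 1 / 2) :
    min ((2 * (i : ℝ) + d) / ((i : ℝ) + c)) (p y₀) ≤
      (1 - ((i : ℝ) + d) / c) *
          ∑ s ∈ (Finset.univ : Finset (Finset κ)).filter (fun s => y ≤ ∑ k ∈ s, a k), (∏ k, if k ∈ s then p k else 1 - p k) +
        (((i : ℝ) + d) / c) *
          ∑ s ∈ (Finset.univ : Finset (Finset κ)).filter (fun s => y - c ≤ ∑ k ∈ s, a k), (∏ k, if k ∈ s then p k else 1 - p k) := by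
  set g : ℝ := p y₀ with hg
  set lam : ℝ := ((i : ℝ) + d) / c with hlam
  set ρ : ℝ := (2 * (i : ℝ) + d) / ((i : ℝ) + c) with hρ
  set P0 : ℝ := ∑ s ∈ (Finset.univ : Finset (Finset κ)).filter (fun s => y ≤ ∑ k ∈ s, a k),
      (∏ k, if k ∈ s then p k else 1 - p k) with hP0
  set Pc : ℝ := ∑ s ∈ (Finset.univ : Finset (Finset κ)).filter (fun s => y - c ≤ ∑ k ∈ s, a k),
      (∏ k, if k ∈ s then p k else 1 - p k) with hPc
  have hw0 : ∀ s : Finset κ, 0 ≤ (∏ k, if k ∈ s then p k else 1 - p k) := bernoulliWeight_nonneg hp0 hp1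
  have hc2 : (2 : ℝ) ≤ c := by exact_mod_cast (by omega : 2 ≤ c)
  have hc0 : (0 : ℝ) < c := by linarith
  have hi1 : (1 : ℝ) ≤ i := by exact_mod_cast hi
  have hcy' : (c : ℝ) + 1 ≤ y := by exact_mod_cast hcy
  have hic0 : (0 : ℝ) < (i : ℝ) + c := by linarith
  have hlam0 : 0 ≤ lam := by rw [hlam]; exact div_nonneg (by linarith) hc0.le
  have hlam1 : lam ≤ 1 := by rw [hlam, div_le_one hc0]; linarith
  have hg0 : 0 ≤ g := hp0 y₀
  -- the hub mean `h = c·λ = i + d` and `1 − ρ = (c − i − d)/(i + c)`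
  set h : ℝ := (i : ℝ) + d with hh
  have hh0 : 0 ≤ h := by rw [hh]; linarith
  have hcne : (c : ℝ) ≠ 0 := hc0.ne'
  have hicne : (i : ℝ) + c ≠ 0 := hic0.ne'
  have hclam : (c : ℝ) * lam = h := by
    rw [hlam, hh, mul_div_assoc']
    exact mul_div_cancel_left₀ _ hcne
  have hrho : (1 - ρ) * ((i : ℝ) + c) = (c : ℝ) - h := by
    rw [hρ, hh, sub_mul, one_mul, div_mul_cancel₀ _ hicne]
    ring
  -- monotonicity `P0 ≤ Pc` and the left side dominates `P0`
  have hP0Pc : P0 ≤ Pc := tail_mono p a hp0 hp1 (by omega)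
  have hLHSP0 : P0 ≤ (1 - lam) * P0 + lam * Pc := by nlinarith
  -- regime I: a block of size `≥ y`
  by_cases hbig : ∃ k, y ≤ a k
  · obtain ⟨k₀, hk₀⟩ := hbig
    have h1 : g ≤ p k₀ := hy₀ k₀
    have h2 : p k₀ ≤ P0 := gate_le_tail_of_size_le p a hp0 hp1 k₀ y hk₀
    exact (min_le_right _ _).trans (h1.trans (h2.trans hLHSP0))
  push Not at hbig
  -- regime II: Cantelli for the joint count `c·ε + W`
  set t : ℝ := 1 - min ρ g with ht
  have hthalf : 1 / 2 ≤ t := by rw [ht]; linarith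
  have htg : 1 - g ≤ t := by rw [ht]; linarith [min_le_right ρ g]
  have htρ : 1 - ρ ≤ t := by rw [ht]; linarith [min_le_left ρ g]
  -- complementary (light) events
  set SK : ℝ := ∑ s ∈ (Finset.univ : Finset (Finset κ)).filter (fun s => ¬ (y ≤ ∑ k ∈ s, a k)),
      (∏ k, if k ∈ s then p k else 1 - p k) with hSK
  set SL : ℝ := ∑ s ∈ (Finset.univ : Finset (Finset κ)).filter (fun s => ¬ (y - c ≤ ∑ k ∈ s, a k)),
      (∏ k, if k ∈ s then p k else 1 - p k) with hSL
  have hK : P0 + SK = 1 := by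
    have hcompl := Finset.sum_filter_add_sum_filter_not (Finset.univ : Finset (Finset κ))
      (fun s => y ≤ ∑ k ∈ s, a k) (fun s => (∏ k, if k ∈ s then p k else 1 - p k))
    rw [sum_bernoulliWeight p] at hcompl
    rw [hP0, hSK]
    exact hcompl
  have hL : Pc + SL = 1 := by
    have hcompl := Finset.sum_filter_add_sum_filter_not (Finset.univ : Finset (Finset κ))
      (fun s => y - c ≤ ∑ k ∈ s, a k) (fun s => (∏ k, if k ∈ s then p k else 1 - p k))
    rw [sum_bernoulliWeight p] at hcompl
    rw [hPc, hSL]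
    exact hcompl
  set P : ℝ := (1 - lam) * SK + lam * SL with hP
  suffices hPt : P ≤ t by
    have e : (1 - lam) * P0 + lam * Pc = 1 - P := by
      rw [hP]
      have e1 : P0 = 1 - SK := by linarith
      have e2 : Pc = 1 - SL := by linarith
      rw [e1, e2]; ring
    rw [e]
    rw [ht] at hPt
    linarith
  -- moments of `W`
  set m' : ℝ := ∑ k, (a k : ℝ) * p k with hm'
  set V' : ℝ := ∑ k, (a k : ℝ) ^ 2 * p k * (1 - p k) with hV'
  set j : ℝ := (y : ℝ) - 1 with hj
  set Δ : ℝ := h + m' - j with hΔdef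
  have hm'eq : m' = Δ + j - h := by rw [hΔdef]; ring
  have hΔ : j + i < Δ := by rw [hΔdef, hh, hj]; linarith
  have hΔpos : 0 < Δ := by
    have : (0 : ℝ) ≤ j := by rw [hj]; linarith
    linarith
  have hjc : (c : ℝ) ≤ j := by rw [hj]; linarith
  have hj0 : (0 : ℝ) ≤ j := by linarith
  -- every block is light: `a k ≤ j`
  have hak : ∀ k, (a k : ℝ) ≤ j := by
    intro k
    have h1 : a k + 1 ≤ y := by have := hbig k; omega
    have : ((a k + 1 : ℕ) : ℝ) ≤ ((y : ℕ) : ℝ) := by exact_mod_cast h1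
    push_cast at this
    rw [hj]; linarith
  -- the centre `C = m + Δ = 2m − j` (`m = h + m'` the mean of the joint count)
  set C : ℝ := h + m' + Δ with hC
  have hCj : C - j = 2 * Δ := by rw [hC, hΔdef]; ring
  -- second moments of `W` about `C` and `C − c`
  have q0 := sum_bernoulliWeight_mul_sq_sub p (fun k => (a k : ℝ)) C
  have q1 := sum_bernoulliWeight_mul_sq_sub p (fun k => (a k : ℝ)) (C - c)
  rw [← hm', ← hV'] at q0 q1
  -- pointwise: on `{¬ y ≤ a(s)}` the count is `≤ j`, so `(C − a(s))² ≥ (2Δ)²`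
  have b0 : (2 * Δ) ^ 2 * SK ≤ ∑ W : Finset κ, (∏ k, if k ∈ W then p k else 1 - p k) * (C - ∑ i ∈ W, (a i : ℝ)) ^ 2 := by
    rw [hSK, Finset.mul_sum]
    calc ∑ s ∈ (Finset.univ : Finset (Finset κ)).filter (fun s => ¬ (y ≤ ∑ k ∈ s, a k)),
          (2 * Δ) ^ 2 * (∏ k, if k ∈ s then p k else 1 - p k)
        ≤ ∑ s ∈ (Finset.univ : Finset (Finset κ)).filter (fun s => ¬ (y ≤ ∑ k ∈ s, a k)),
          (∏ k, if k ∈ s then p k else 1 - p k) * (C - ∑ i ∈ s, (a i : ℝ)) ^ 2 := by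
            refine Finset.sum_le_sum fun s hs => ?_
            rw [Finset.mem_filter, not_le] at hs
            have h1 : ∑ k ∈ s, a k + 1 ≤ y := by have := hs.2; omega
            have h2 : ((∑ k ∈ s, a k + 1 : ℕ) : ℝ) ≤ ((y : ℕ) : ℝ) := by exact_mod_cast h1
            push_cast at h2
            have hge : 2 * Δ ≤ C - ∑ i ∈ s, (a i : ℝ) := by rw [← hCj, hj]; linarith
            have hsq : (2 * Δ) ^ 2 ≤ (C - ∑ i ∈ s, (a i : ℝ)) ^ 2 := pow_le_pow_left₀ (by linarith) hge 2
            rw [mul_comm]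
            exact mul_le_mul_of_nonneg_left hsq (hw0 s)
      _ ≤ ∑ W : Finset κ, (∏ k, if k ∈ W then p k else 1 - p k) * (C - ∑ i ∈ W, (a i : ℝ)) ^ 2 :=
            Finset.sum_le_sum_of_subset_of_nonneg (Finset.filter_subset _ _)
              fun W _ _ => mul_nonneg (hw0 W) (sq_nonneg _)
  -- pointwise: on `{¬ y − c ≤ a(s)}` the count is `≤ j − c`, so `(C − c − a(s))² ≥ (2Δ)²`
  have b1 : (2 * Δ) ^ 2 * SL ≤ ∑ W : Finset κ, (∏ k, if k ∈ W then p k else 1 - p k) * (C - c - ∑ i ∈ W, (a i : ℝ)) ^ 2 := by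
    rw [hSL, Finset.mul_sum]
    calc ∑ s ∈ (Finset.univ : Finset (Finset κ)).filter (fun s => ¬ (y - c ≤ ∑ k ∈ s, a k)),
          (2 * Δ) ^ 2 * (∏ k, if k ∈ s then p k else 1 - p k)
        ≤ ∑ s ∈ (Finset.univ : Finset (Finset κ)).filter (fun s => ¬ (y - c ≤ ∑ k ∈ s, a k)),
          (∏ k, if k ∈ s then p k else 1 - p k) * (C - c - ∑ i ∈ s, (a i : ℝ)) ^ 2 := by
            refine Finset.sum_le_sum fun s hs => ?_
            rw [Finset.mem_filter, not_le] at hs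
            have h1 : ∑ k ∈ s, a k + c + 1 ≤ y := by have := hs.2; omega
            have h2 : ((∑ k ∈ s, a k + c + 1 : ℕ) : ℝ) ≤ ((y : ℕ) : ℝ) := by exact_mod_cast h1
            push_cast at h2
            have hge : 2 * Δ ≤ C - c - ∑ i ∈ s, (a i : ℝ) := by rw [← hCj, hj]; linarith
            have hsq : (2 * Δ) ^ 2 ≤ (C - c - ∑ i ∈ s, (a i : ℝ)) ^ 2 := pow_le_pow_left₀ (by linarith) hge 2
            rw [mul_comm]
            exact mul_le_mul_of_nonneg_left hsq (hw0 s)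
      _ ≤ ∑ W : Finset κ, (∏ k, if k ∈ W then p k else 1 - p k) * (C - c - ∑ i ∈ W, (a i : ℝ)) ^ 2 :=
            Finset.sum_le_sum_of_subset_of_nonneg (Finset.filter_subset _ _)
              fun W _ _ => mul_nonneg (hw0 W) (sq_nonneg _)
  -- Cantelli: `4Δ²·P ≤ Var + Δ²` with the joint variance `V' + c²λ(1−λ)`
  have hcant : (2 * Δ) ^ 2 * P ≤ V' + Δ ^ 2 + (c : ℝ) ^ 2 * lam * (1 - lam) := by
    have e : (1 - lam) * ((C - m') ^ 2 + V') + lam * ((C - c - m') ^ 2 + V') =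
        V' + Δ ^ 2 + (c : ℝ) ^ 2 * lam * (1 - lam) := by
      rw [hC]
      linear_combination ((c : ℝ) * lam - h - 2 * Δ) * hclam
    calc (2 * Δ) ^ 2 * P = (1 - lam) * ((2 * Δ) ^ 2 * SK) + lam * ((2 * Δ) ^ 2 * SL) := by rw [hP]; ring
      _ ≤ (1 - lam) * ((C - m') ^ 2 + V') + lam * ((C - c - m') ^ 2 + V') := by
          rw [← q0, ← q1]
          exact add_le_add (mul_le_mul_of_nonneg_left b0 (by linarith)) (mul_le_mul_of_nonneg_left b1 hlam0)
      _ = V' + Δ ^ 2 + (c : ℝ) ^ 2 * lam * (1 - lam) := e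
  -- variance of the blocks: `V' ≤ j·t·m'` (every block `≤ j`, every defect `1 − p k ≤ 1 − g ≤ t`)
  have hV'le : V' ≤ j * t * m' := by
    rw [hV', hm', Finset.mul_sum]
    refine Finset.sum_le_sum fun k _ => ?_
    have hpk0 : 0 ≤ p k := hp0 k
    have hak0 : (0 : ℝ) ≤ a k := by positivity
    have hdef : 1 - p k ≤ t := le_trans (by linarith [hy₀ k]) htg
    have hdef0 : 0 ≤ 1 - p k := by linarith [hp1 k]
    have h1 : (a k : ℝ) * (1 - p k) ≤ j * t := mul_le_mul (hak k) hdef hdef0 hj0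
    have h2 : (a k : ℝ) * (1 - p k) * ((a k : ℝ) * p k) ≤ j * t * ((a k : ℝ) * p k) :=
      mul_le_mul_of_nonneg_right h1 (mul_nonneg hak0 hpk0)
    calc (a k : ℝ) ^ 2 * p k * (1 - p k) = (a k : ℝ) * (1 - p k) * ((a k : ℝ) * p k) := by ring
      _ ≤ j * t * ((a k : ℝ) * p k) := h2
  -- variance of the hub, discounted by its credit: `c²λ(1−λ) = h·(c − h) ≤ h·t·(i + c)`
  have hhub : (c : ℝ) ^ 2 * lam * (1 - lam) ≤ t * ((i : ℝ) + c) * h := by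
    have e1 : (c : ℝ) ^ 2 * lam * (1 - lam) = h * ((c : ℝ) - h) := by
      linear_combination ((c : ℝ) - (c : ℝ) * lam - h) * hclam
    have e2 : (c : ℝ) - h ≤ t * ((i : ℝ) + c) := by
      rw [← hrho]
      exact mul_le_mul_of_nonneg_right htρ hic0.le
    rw [e1]
    calc h * ((c : ℝ) - h) ≤ h * (t * ((i : ℝ) + c)) := mul_le_mul_of_nonneg_left e2 hh0
      _ = t * ((i : ℝ) + c) * h := by ring
  -- the key inequality `j·m' + (i + c)·h ≤ 2Δ²`
  have hkey : j * m' + ((i : ℝ) + c) * h ≤ 2 * Δ ^ 2 := by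
    have hhlt : h < (i : ℝ) + 1 := by rw [hh]; linarith
    have e : 2 * Δ ^ 2 - (j * m' + ((i : ℝ) + c) * h) =
        (2 * Δ + j) * (Δ - j - i) + (i : ℝ) * (2 * Δ + j - h) + (j - c) * h := by
      rw [hm'eq]; ring
    have t1 : 0 ≤ (2 * Δ + j) * (Δ - j - i) := mul_nonneg (by linarith) (by linarith)
    have t2 : 0 ≤ (i : ℝ) * (2 * Δ + j - h) := mul_nonneg (by linarith) (by linarith)
    have t3 : 0 ≤ (j - c) * h := mul_nonneg (by linarith) hh0
    linarith
  -- assemble: `4Δ² P ≤ t(j m' + (i+c) h) + Δ² ≤ (2t + 1)Δ² ≤ 4tΔ²`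
  have hm'0 : 0 ≤ m' := by
    rw [hm']; exact Finset.sum_nonneg fun k _ => mul_nonneg (by positivity) (hp0 k)
  have h4 : (2 * Δ) ^ 2 * P ≤ (2 * Δ) ^ 2 * t := by
    have e1 : t * (j * m' + ((i : ℝ) + c) * h) = j * t * m' + t * ((i : ℝ) + c) * h := by ring
    have s1 : V' + Δ ^ 2 + (c : ℝ) ^ 2 * lam * (1 - lam) ≤ t * (j * m' + ((i : ℝ) + c) * h) + Δ ^ 2 := by
      rw [e1]; linarith [hV'le, hhub]
    have s2 : t * (j * m' + ((i : ℝ) + c) * h) ≤ t * (2 * Δ ^ 2) := mul_le_mul_of_nonneg_left hkey (by linarith)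
    have e2 : (2 * Δ) ^ 2 * t = t * (2 * Δ ^ 2) + (2 * t - 1) * Δ ^ 2 + Δ ^ 2 := by ring
    have s3' : 0 ≤ (2 * t - 1) * Δ ^ 2 := mul_nonneg (by linarith) (sq_nonneg Δ)
    have s3 : t * (2 * Δ ^ 2) + Δ ^ 2 ≤ (2 * Δ) ^ 2 * t := by rw [e2]; linarith
    linarith [hcant]
  have hΔ2 : 0 < (2 * Δ) ^ 2 := by positivity
  exact le_of_mul_le_mul_left h4 hΔ2

/-- **TP1-sliver, unconditional** (= (B-4) of PROFILE-PROOF-G10 after census-2 gen 46's vertex reduction R1).  Gates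
`0 ≤ p k ≤ 1` with least reliable blob `y₀`; integer sizes `a k ≥ 1`; integers `1 ≤ i`, `i + 1 ≤ c`, `c + 1 ≤ y`; a real `0 < d < 1`
with `i + d < c`; and `2y − 2 − d < EW`.  Then `min((2i+d)/(i+c), p y₀) ≤ (1 − (i+d)/c)·P(y ≤ W) + ((i+d)/c)·P(y − c ≤ W)`:
gates `≥ 1/2` by `twoPointHub_sliver_of_half_le_gate` (census-1 gen 11), least gate `< 1/2` by
`twoPointHub_sliver_of_min_le_half`. [this work] -/
theorem twoPointHub_sliver (p : κ → ℝ) (a : κ → ℕ) (hp0 : ∀ k, 0 ≤ p k) (hp1 : ∀ k, p k ≤ 1) (ha : ∀ k, 1 ≤ a k)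
    (y₀ : κ) (hy₀ : ∀ k, p y₀ ≤ p k) (i c y : ℕ) (d : ℝ) (hi : 1 ≤ i) (hic : i + 1 ≤ c) (hcy : c + 1 ≤ y)
    (hd0 : 0 < d) (hd1 : d < 1) (hdc : (i : ℝ) + d < c)
    (hEW : 2 * (y : ℝ) - 2 - d < ∑ k, (a k : ℝ) * p k) :
    min ((2 * (i : ℝ) + d) / ((i : ℝ) + c)) (p y₀) ≤
      (1 - ((i : ℝ) + d) / c) *
          ∑ s ∈ (Finset.univ : Finset (Finset κ)).filter (fun s => y ≤ ∑ k ∈ s, a k), (∏ k, if k ∈ s then p k else 1 - p k) +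
        (((i : ℝ) + d) / c) *
          ∑ s ∈ (Finset.univ : Finset (Finset κ)).filter (fun s => y - c ≤ ∑ k ∈ s, a k), (∏ k, if k ∈ s then p k else 1 - p k) := by
  by_cases hhalf : 1 / 2 ≤ p y₀
  · exact twoPointHub_sliver_of_half_le_gate p a hp0 hp1 ha y₀ hy₀ hhalf i c y d hi hic hcy hd0 hd1 hdc hEW
  · push Not at hhalf
    exact twoPointHub_sliver_of_min_le_half p a hp0 hp1 y₀ hy₀ i c y d hi hic hcy hd0 hd1 hdc hEW
      ((min_le_right _ _).trans hhalf.le)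

end IndepBlob

end Quant

end Summit.CriticalPhenomena.PercolationContinuityZ3.Theorems
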